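import Summits.CriticalPhenomena.PercolationContinuityZ3.Theorems.PercGamblersRuinBGNOffTheFloorStructure
import Summits.CriticalPhenomena.PercolationContinuityZ3.Theses.PercFiniteBoxLRO
import Literature.Barriers.CriticalPhenomena.KozmaNachmiasLemma11Steps
import Literature.Probability.Percolation.HalfSpacePinnedPairs
import Literature.Probability.Percolation.Crossings
import Literature.Probability.Percolation.SiteConnectionTools
import Literature.Probability.Percolation.InequalitiesProofs
import HarnessLib

/-!
# `BGNOffTheFloor` (stmt-CriticalPhenomena-7773) — the ladder step from linear-scale long-range order

Crux `Summit.CriticalPhenomena.PercolationContinuityZ3.Theses.PercGamblersRuin.BGNOffTheFloor`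
(route `PercGamblersRuin`, item stmt-CriticalPhenomena-7773), line `registered` (birth skeleton
`Cruxes/BGNOffTheFloor/Lines/birth.lean`; stub-worker of the lead-c3 wave, integrated by the lead).
Support lemmas (`--supports`), proved. They record an EDGE between routes: the ladder step
`ClimbExtension` of this crux (and, in a jump world, the failure of every instance of the crux) follows
from the open crux `LinearScaleLROOfTheta` (`X_D`, stmt-CriticalPhenomena-0855, route `PercFiniteBoxLRO`),
indeed from its AXIAL instances at `p_c` alone.

Write `R(A) = {z : ℤ³ | -A < z₀}`, `E(A, L) = {∃ y, y₀ = L ∧ 0 ↔ y in R(A)}`, `e_n(a,b) = P_{p_c}(E(an, bn))`.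

* `OffFloor.climb_ge_of_boxLRO` — **FKG chaining of linear-scale box connections above the floor**:
  if at some `p` one has linear-scale box LRO `P_p(x ↔ y in Λ(K n)) ≥ ρ` for all `n ≥ 1`, `x, y ∈ Λ(n)`
  (`ρ > 0`), then for all `a ≥ 1`, `b`, and `n ≥ max K 1`: `P_p(E(a n, b n)) ≥ ρ ^ (max K 1 * b)`.
  Proof: with `K' = max K 1`, `m = n / K'`, the `K' b` boxes `(2i+1) m e₀ + Λ(K' m)` all lie in `R(a n)`
  (their bottoms are at height `≥ m - K' m > -n ≥ -a n`), consecutive axis points `2 i m e₀`,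
  `2 (i+1) m e₀` lie in the inner box `(2i+1) m e₀ + Λ(m)`, so each step has probability `≥ ρ`
  (translation invariance), the steps glue inside `R(a n)` (transitivity of `↔ in`), Harris–FKG
  multiplies the lower bounds, and the endpoint `2 K' b m e₀` has height `≥ b n` (`n < K'(m+1) ≤ 2 K' m`),
  so ceiling monotonicity (`OffFloor.climb_real_mono`) brings the level down to `b n`.
* `OffFloor.climb_ge_of_axialLRO`, `OffFloor.climb_eventually_ge_of_axialLRO_of_theta_pos` — the chain only
  consumes the AXIAL pairs `∓ m e₀ ∈ Λ(m)`; in a jump world with axial linear-scale LRO at `p_c` every pair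
  `(a,b)`, `a ≥ 1`, is climbable with probability bounded below eventually (`λ* = 0`).
* `stub_climbExtensionOfAxialLRO` (registered glue stub of the line) — hence axial linear-scale LRO at `p_c`
  in a jump world implies the ladder step `ClimbExtension` θ-blindly (case `θ(p_c) = 0`:
  `OffFloor.offFloor_of_theta_eq_zero`; case `θ(p_c) > 0`: the hypothesis `liminf_n e_n(a,b+1) = 0` is
  refuted), and `OffFloor.theta_eq_zero_of_unitRatioBGN_of_axialLRO`: under the same hypothesis the
  weakest instance family `UnitRatioBGN` of the crux already forces `θ(p_c) = 0`.
* `climbExtension_of_linearScaleLROOfTheta`, `OffFloor.bgnOffTheFloor_iff_continuity_of_linearScaleLROOfTheta`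
  — the same from the crux `LinearScaleLROOfTheta` of route `PercFiniteBoxLRO` verbatim: under `X_D` the whole
  crux `BGNOffTheFloor`, and already `UnitRatioBGN`, are EQUIVALENT to `θ(p_c) = 0`.

References: R. Cerf, *A lower bound on the two-arms exponent for critical percolation on the lattice*,
Ann. Probab. 43 (2015), arXiv:1306.3105 (p. 5, "the missing ingredient" `X_D`); G. Grimmett,
*Percolation*, 2nd ed. (1999), §7.3.
-/

noncomputable section

namespace Summit.CriticalPhenomena.PercolationContinuityZ3.Theorems

open MeasureTheory Filter Literature.Probability.Percolation Literature.Probability.LatticeModels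
open Literature.Barriers.CriticalPhenomena (real_openConnIn_image_iso mem_openConnIn_trans_of_subset
  mem_openConnIn_rfl)
open scoped Topology

namespace OffFloor

/-! ### Axis points `t e₀ = Pi.single 0 t` -/

/-- The transverse coordinates of the axis point `t e₀` vanish. [folklore] -/
theorem axisPt_apply_of_ne_zero (t : ℤ) {i : Fin 3} (hi : i ≠ 0) : (Pi.single 0 t : Site 3) i = 0 := by
  simp [hi]

/-- Axis points add: `s e₀ + t e₀ = (s + t) e₀`. [folklore] -/
theorem axisPt_add (s t : ℤ) : (Pi.single 0 s : Site 3) + Pi.single 0 t = Pi.single 0 (s + t) := by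
  simp [Pi.single_add]

/-- `t e₀ ∈ Λ(m)` if `|t| ≤ m`. [folklore] -/
theorem axisPt_mem_box {t : ℤ} {m : ℕ} (h1 : -(m : ℤ) ≤ t) (h2 : t ≤ m) :
    (Pi.single 0 t : Site 3) ∈ box 3 m := by
  rw [mem_box]
  intro i
  by_cases hi : i = 0
  · subst hi; simp [h1, h2]
  · rw [axisPt_apply_of_ne_zero t hi]; omega

/-! ### Axial linear-scale long-range order at one parameter -/

/-- AXIAL linear-scale long-range order at the parameter `p` with constants `ρ`, `K`
(`P_p(-m e₀ ↔ m e₀ in Λ(K m)) ≥ ρ` for all `m ≥ 1`): the constant `K` may be enlarged (the event grows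
with the box). [folklore] -/
theorem axialLRO_mono {p : unitInterval} {ρ : ℝ} {K K' : ℕ}
    (h : ∀ m : ℕ, 1 ≤ m → ρ ≤ (bondPercolation (zdGraph 3) p).real
      (openConnIn (↑(box 3 (K * m)) : Set (Site 3)) (Pi.single 0 (-(m : ℤ))) (Pi.single 0 (m : ℤ))))
    (hK : K ≤ K') :
    ∀ m : ℕ, 1 ≤ m → ρ ≤ (bondPercolation (zdGraph 3) p).real
      (openConnIn (↑(box 3 (K' * m)) : Set (Site 3)) (Pi.single 0 (-(m : ℤ))) (Pi.single 0 (m : ℤ))) := by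
  intro m hm
  refine (h m hm).trans (measureReal_mono (openConnIn_mono ?_ _ _))
  intro z hz
  simp only [Finset.mem_coe, mem_box] at hz ⊢
  intro i
  have := hz i
  have hKK : ((K * m : ℕ) : ℤ) ≤ ((K' * m : ℕ) : ℤ) := by exact_mod_cast Nat.mul_le_mul_right m hK
  omega

/-- Linear-scale BOX long-range order (`P_p(x ↔ y in Λ(K n)) ≥ ρ` for all `n ≥ 1`, `x, y ∈ Λ(n)`,
the conclusion of `LinearScaleLROOfTheta`) contains the axial form (`∓ m e₀ ∈ Λ(m)`). [folklore] -/
theorem axialLRO_of_boxLRO {p : unitInterval} {ρ : ℝ} {K : ℕ}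
    (h : ∀ n : ℕ, 1 ≤ n → ∀ x ∈ box 3 n, ∀ y ∈ box 3 n,
      ρ ≤ (bondPercolation (zdGraph 3) p).real (openConnIn (↑(box 3 (K * n)) : Set (Site 3)) x y)) :
    ∀ m : ℕ, 1 ≤ m → ρ ≤ (bondPercolation (zdGraph 3) p).real
      (openConnIn (↑(box 3 (K * m)) : Set (Site 3)) (Pi.single 0 (-(m : ℤ))) (Pi.single 0 (m : ℤ))) :=
  fun m hm => h m hm _ (axisPt_mem_box le_rfl (by omega)) _ (axisPt_mem_box (by omega) le_rfl)

/-- **One step of the chain, translated**: the axis points `2 m i e₀` and `2 m (i+1) e₀` are joined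
inside the box `(2i+1) m e₀ + Λ(K m)` with probability `≥ ρ` (translation by `(2i+1) m e₀` of the
LRO event for `∓ m e₀ ∈ Λ(m)`). [folklore] -/
theorem step_ge {p : unitInterval} {ρ : ℝ} {K : ℕ}
    (h : ∀ m : ℕ, 1 ≤ m → ρ ≤ (bondPercolation (zdGraph 3) p).real
      (openConnIn (↑(box 3 (K * m)) : Set (Site 3)) (Pi.single 0 (-(m : ℤ))) (Pi.single 0 (m : ℤ)))) {m : ℕ} (hm : 1 ≤ m) (i : ℕ) :
    ρ ≤ (bondPercolation (zdGraph 3) p).real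
      (openConnIn ((zdShiftIso ((Pi.single 0 ((2 * i + 1) * m) : Site 3))) '' (↑(box 3 (K * m)) : Set (Site 3)))
        ((Pi.single 0 (2 * m * i) : Site 3)) ((Pi.single 0 (2 * m * (i + 1)) : Site 3))) := by
  have key := real_openConnIn_image_iso p (zdShiftIso ((Pi.single 0 ((2 * i + 1) * m) : Site 3)))
    (↑(box 3 (K * m)) : Set (Site 3)) ((Pi.single 0 (-(m : ℤ)) : Site 3)) ((Pi.single 0 (m : ℤ) : Site 3))
  rw [zdShiftIso_apply, zdShiftIso_apply, axisPt_add, axisPt_add] at key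
  have e1 : -(m : ℤ) + (2 * i + 1) * m = 2 * m * i := by ring
  have e2 : (m : ℤ) + (2 * i + 1) * m = 2 * m * (i + 1) := by ring
  rw [e1, e2] at key
  rw [key]
  exact h m hm

/-- The translated boxes lie above the floor `-A` as soon as `K m < A + m`. [folklore] -/
theorem shiftBox_subset_region {K m : ℕ} {A : ℤ} (hA : (K * m : ℤ) < A + m) (i : ℕ) :
    (zdShiftIso ((Pi.single 0 ((2 * i + 1) * m) : Site 3))) '' (↑(box 3 (K * m)) : Set (Site 3)) ⊆
      {z : Site 3 | -A < z 0} := by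
  rintro z ⟨u, hu, rfl⟩
  simp only [Finset.mem_coe, mem_box] at hu
  have h0 := (hu 0).1
  simp only [Set.mem_setOf_eq, zdShiftIso_apply, Pi.add_apply, Pi.single_eq_same]
  push_cast at h0 ⊢
  nlinarith

/-- **The chain**: `P_p(0 ↔ 2 m k e₀ in R(A)) ≥ ρ ^ k` (Harris–FKG and gluing of the `k` steps).
[folklore] -/
theorem chain_ge {p : unitInterval} {ρ : ℝ} {K : ℕ}
    (h : ∀ m : ℕ, 1 ≤ m → ρ ≤ (bondPercolation (zdGraph 3) p).real
      (openConnIn (↑(box 3 (K * m)) : Set (Site 3)) (Pi.single 0 (-(m : ℤ))) (Pi.single 0 (m : ℤ))))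
    (hρ : 0 ≤ ρ) {m : ℕ}
    (hm : 1 ≤ m) {A : ℤ} (hA : (K * m : ℤ) < A + m) (hA0 : 0 < A) (k : ℕ) :
    ρ ^ k ≤ (bondPercolation (zdGraph 3) p).real
      (openConnIn {z : Site 3 | -A < z 0} 0 ((Pi.single 0 (2 * m * k) : Site 3))) := by
  set P := bondPercolation (zdGraph 3) p with hP
  set R : Set (Site 3) := {z : Site 3 | -A < z 0} with hR
  induction k with
  | zero =>
    have h0 : (0 : Site 3) ∈ R := by simp [hR]; omega
    have huniv : openConnIn R (0 : Site 3) 0 = Set.univ :=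
      Set.eq_univ_of_forall fun ω => mem_openConnIn_rfl h0 ω
    simp only [Nat.cast_zero, mul_zero, Pi.single_zero, pow_zero, huniv, probReal_univ, le_refl]
  | succ k ih =>
    set S : Set (Site 3) :=
      (zdShiftIso ((Pi.single 0 ((2 * k + 1) * m) : Site 3))) '' (↑(box 3 (K * m)) : Set (Site 3)) with hS
    have hSR : S ⊆ R := shiftBox_subset_region hA k
    have hstep : ρ ≤ P.real (openConnIn S ((Pi.single 0 (2 * m * k) : Site 3)) ((Pi.single 0 (2 * m * (k + 1)) : Site 3))) :=
      step_ge h hm k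
    have hincl : openConnIn R (0 : Site 3) ((Pi.single 0 (2 * m * k) : Site 3)) ∩
        openConnIn S ((Pi.single 0 (2 * m * k) : Site 3)) ((Pi.single 0 (2 * m * (k + 1)) : Site 3)) ⊆
        openConnIn R (0 : Site 3) ((Pi.single 0 (2 * m * ((k + 1 : ℕ) : ℤ)) : Site 3)) := by
      rintro ω ⟨h1, h2⟩
      have := mem_openConnIn_trans_of_subset h1 h2 subset_rfl hSR
      simpa [Nat.cast_succ] using this
    calc ρ ^ (k + 1) = ρ ^ k * ρ := pow_succ ρ k
      _ ≤ P.real (openConnIn R (0 : Site 3) ((Pi.single 0 (2 * m * k) : Site 3))) *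
            P.real (openConnIn S ((Pi.single 0 (2 * m * k) : Site 3)) ((Pi.single 0 (2 * m * (k + 1)) : Site 3))) :=
          mul_le_mul ih hstep hρ measureReal_nonneg
      _ ≤ P.real (openConnIn R (0 : Site 3) ((Pi.single 0 (2 * m * k) : Site 3)) ∩
            openConnIn S ((Pi.single 0 (2 * m * k) : Site 3)) ((Pi.single 0 (2 * m * (k + 1)) : Site 3))) :=
          harris_fkg_holds (zdGraph 3) p (isUpperSet_openConnIn _ _ _) (isUpperSet_openConnIn _ _ _)
            (measurableSet_openConnIn_of_countable _ _ _) (measurableSet_openConnIn_of_countable _ _ _)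
      _ ≤ P.real (openConnIn R (0 : Site 3) ((Pi.single 0 (2 * m * ((k + 1 : ℕ) : ℤ)) : Site 3))) :=
          measureReal_mono hincl

/-- **Climbing above a receding floor from AXIAL linear-scale LRO.** Under axial linear-scale LRO at
`p` (constants `ρ ≥ 0`, `K`), for `a ≥ 1`, every `b` and every `n ≥ max K 1`:
`P_p(E(a n, b n)) ≥ ρ ^ (max K 1 * b)`. This is the EXACT input the chain consumes. [folklore] -/
theorem climb_ge_of_axialLRO {p : unitInterval} {ρ : ℝ} {K : ℕ}
    (h : ∀ m : ℕ, 1 ≤ m → ρ ≤ (bondPercolation (zdGraph 3) p).real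
      (openConnIn (↑(box 3 (K * m)) : Set (Site 3)) (Pi.single 0 (-(m : ℤ))) (Pi.single 0 (m : ℤ))))
    (hρ : 0 ≤ ρ) {a : ℕ} (ha : 1 ≤ a) (b n : ℕ) (hn : max K 1 ≤ n) :
    ρ ^ (max K 1 * b) ≤ (bondPercolation (zdGraph 3) p).real
      {ω | ∃ y : Site 3, y 0 = ((b * n : ℕ) : ℤ) ∧
        ω ∈ openConnIn {z : Site 3 | -((a * n : ℕ) : ℤ) < z 0} 0 y} := by
  set K' := max K 1 with hK'
  have hK'1 : 1 ≤ K' := le_max_right _ _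
  have h' := axialLRO_mono h (le_max_left K 1)
  set m := n / K' with hm
  have hK'pos : 0 < K' := lt_of_lt_of_le Nat.one_pos hK'1
  have hm1 : 1 ≤ m := by
    rw [hm]; exact (Nat.le_div_iff_mul_le hK'pos).2 (by rw [one_mul]; exact hn)
  have hKm : K' * m ≤ n := by rw [hm, mul_comm]; exact Nat.div_mul_le_self n K'
  have hnlt : n < K' * (m + 1) := by
    have := Nat.lt_div_mul_add (a := n) hK'pos
    rw [hm, mul_add, mul_one, mul_comm K' (n / K')]; exact this
  have han : n ≤ a * n := Nat.le_mul_of_pos_left n (by omega)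
  -- the boxes lie above the floor `-(a n)`
  have hA : ((K' * m : ℕ) : ℤ) < ((a * n : ℕ) : ℤ) + m := by
    have : K' * m < a * n + m := by omega
    exact_mod_cast this
  have hA' : ((K' : ℤ) * m) < ((a * n : ℕ) : ℤ) + m := by push_cast at hA ⊢; exact hA
  have hA0 : (0 : ℤ) < ((a * n : ℕ) : ℤ) := by
    have : 0 < a * n := Nat.mul_pos (by omega) (by omega)
    exact_mod_cast this
  -- the chain of `K' b` steps reaches height `2 m K' b ≥ b n`
  have hchain := chain_ge h' hρ hm1 hA' hA0 (K' * b)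
  have h2m : K' * (m + 1) ≤ 2 * m * K' := by nlinarith [Nat.mul_le_mul_left K' hm1]
  have hlevel : b * n ≤ 2 * m * (K' * b) :=
    calc b * n ≤ b * (K' * (m + 1)) := Nat.mul_le_mul_left b hnlt.le
      _ ≤ b * (2 * m * K') := Nat.mul_le_mul_left b h2m
      _ = 2 * m * (K' * b) := by ring
  -- `{0 ↔ 2 m K' b e₀ in R} ⊆ E(a n, 2 m K' b)`
  have hsub : openConnIn {z : Site 3 | -((a * n : ℕ) : ℤ) < z 0} (0 : Site 3)
      ((Pi.single 0 (2 * (m : ℤ) * ((K' * b : ℕ) : ℤ)) : Site 3)) ⊆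
      {ω | ∃ y : Site 3, y 0 = ((2 * m * (K' * b) : ℕ) : ℤ) ∧
        ω ∈ openConnIn {z : Site 3 | -((a * n : ℕ) : ℤ) < z 0} 0 y} := by
    intro ω hω
    refine ⟨(Pi.single 0 (2 * (m : ℤ) * ((K' * b : ℕ) : ℤ)) : Site 3), ?_, hω⟩
    rw [Pi.single_eq_same]; push_cast; ring
  calc ρ ^ (K' * b)
      ≤ (bondPercolation (zdGraph 3) p).real (openConnIn {z : Site 3 | -((a * n : ℕ) : ℤ) < z 0}
          (0 : Site 3) ((Pi.single 0 (2 * (m : ℤ) * ((K' * b : ℕ) : ℤ)) : Site 3))) := hchain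
    _ ≤ (bondPercolation (zdGraph 3) p).real
          {ω | ∃ y : Site 3, y 0 = ((2 * m * (K' * b) : ℕ) : ℤ) ∧
            ω ∈ openConnIn {z : Site 3 | -((a * n : ℕ) : ℤ) < z 0} 0 y} := measureReal_mono hsub
    _ ≤ (bondPercolation (zdGraph 3) p).real
          {ω | ∃ y : Site 3, y 0 = ((b * n : ℕ) : ℤ) ∧
            ω ∈ openConnIn {z : Site 3 | -((a * n : ℕ) : ℤ) < z 0} 0 y} :=
        climb_real_mono p le_rfl (by positivity) (by exact_mod_cast hlevel)

/-- **Climbing above a receding floor from linear-scale box LRO** (the conclusion of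
`LinearScaleLROOfTheta` at one `p`): `P_p(E(a n, b n)) ≥ ρ ^ (max K 1 * b)` for `a ≥ 1`, `n ≥ max K 1`.
[folklore] -/
theorem climb_ge_of_boxLRO {p : unitInterval} {ρ : ℝ} {K : ℕ}
    (h : ∀ n : ℕ, 1 ≤ n → ∀ x ∈ box 3 n, ∀ y ∈ box 3 n,
      ρ ≤ (bondPercolation (zdGraph 3) p).real (openConnIn (↑(box 3 (K * n)) : Set (Site 3)) x y))
    (hρ : 0 ≤ ρ) {a : ℕ} (ha : 1 ≤ a) (b n : ℕ) (hn : max K 1 ≤ n) :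
    ρ ^ (max K 1 * b) ≤ (bondPercolation (zdGraph 3) p).real
      {ω | ∃ y : Site 3, y 0 = ((b * n : ℕ) : ℤ) ∧
        ω ∈ openConnIn {z : Site 3 | -((a * n : ℕ) : ℤ) < z 0} 0 y} :=
  climb_ge_of_axialLRO (axialLRO_of_boxLRO h) hρ ha b n hn

/-- **The exact missing estimate for the stub, typed**: AXIAL linear-scale LRO at `p_c` in a jump world
(`θ(p_c) > 0 → ∃ ρ > 0, K, ∀ m ≥ 1, P_{p_c}(-m e₀ ↔ m e₀ in Λ(K m)) ≥ ρ`) makes every pair `(a,b)`,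
`a ≥ 1`, climbable with probability bounded below eventually. [folklore] -/
theorem climb_eventually_ge_of_axialLRO_of_theta_pos
    (hAx : 0 < theta (zdGraph 3) 0 (criticalProbI 3) →
      ∃ ρ : ℝ, 0 < ρ ∧ ∃ K : ℕ, ∀ m : ℕ, 1 ≤ m →
        ρ ≤ (bondPercolation (zdGraph 3) (criticalProbI 3)).real
          (openConnIn (↑(box 3 (K * m)) : Set (Site 3)) (Pi.single 0 (-(m : ℤ))) (Pi.single 0 (m : ℤ))))
    (hθ : 0 < theta (zdGraph 3) 0 (criticalProbI 3)) {a : ℕ} (ha : 1 ≤ a) (b : ℕ) :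
    ∃ η : ℝ, 0 < η ∧ ∃ N : ℕ, ∀ n : ℕ, N ≤ n →
      η ≤ (bondPercolation (zdGraph 3) (criticalProbI 3)).real
        {ω | ∃ y : Site 3, y 0 = ((b * n : ℕ) : ℤ) ∧
          ω ∈ openConnIn {z : Site 3 | -((a * n : ℕ) : ℤ) < z 0} 0 y} := by
  obtain ⟨ρ, hρ, K, hK⟩ := hAx hθ
  exact ⟨ρ ^ (max K 1 * b), pow_pos hρ _, max K 1, fun n hn =>
    climb_ge_of_axialLRO (p := criticalProbI 3) hK hρ.le ha b n hn⟩

/-- **In a jump world with linear-scale box LRO no pair `(a, b)`, `a ≥ 1`, is off the floor**: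
`LinearScaleLROOfTheta` and `θ(p_c) > 0` give `η > 0` and `N` with `e_n(a,b) ≥ η` for all `n ≥ N`.
[folklore] -/
theorem climb_eventually_ge_of_linearScaleLRO_of_theta_pos
    (hX : Theses.PercFiniteBoxLRO.LinearScaleLROOfTheta)
    (hθ : 0 < theta (zdGraph 3) 0 (criticalProbI 3)) {a : ℕ} (ha : 1 ≤ a) (b : ℕ) :
    ∃ η : ℝ, 0 < η ∧ ∃ N : ℕ, ∀ n : ℕ, N ≤ n →
      η ≤ (bondPercolation (zdGraph 3) (criticalProbI 3)).real
        {ω | ∃ y : Site 3, y 0 = ((b * n : ℕ) : ℤ) ∧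
          ω ∈ openConnIn {z : Site 3 | -((a * n : ℕ) : ℤ) < z 0} 0 y} := by
  obtain ⟨ρ, hρ, K, hK⟩ := hX (criticalProbI 3) hθ
  exact ⟨ρ ^ (max K 1 * b), pow_pos hρ _, max K 1, fun n hn =>
    climb_ge_of_boxLRO (p := criticalProbI 3) hK hρ.le ha b n hn⟩

end OffFloor

/-- **`LinearScaleLROOfTheta ⟹ stub_climbExtension`** (registered signature of the stub, verbatim, as
the conclusion). Case `θ(p_c) = 0`: every pair is off the floor (`OffFloor.offFloor_of_theta_eq_zero`).
Case `θ(p_c) > 0`: by `OffFloor.climb_eventually_ge_of_linearScaleLRO_of_theta_pos` the hypothesis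
`liminf_n e_n(a, b+1) = 0` fails, so the implication holds vacuously. [folklore] -/
theorem climbExtension_of_linearScaleLROOfTheta
    (hX : Theses.PercFiniteBoxLRO.LinearScaleLROOfTheta) :
    ∀ a b : ℕ, 1 ≤ a → a < b →
    (∀ ε : ℝ, 0 < ε → ∃ᶠ n : ℕ in atTop,
      (bondPercolation (zdGraph 3) (criticalProbI 3)).real
          {ω | ∃ y : Site 3, y 0 = (((b + 1) * n : ℕ) : ℤ) ∧
            ω ∈ openConnIn {z : Site 3 | -((a * n : ℕ) : ℤ) < z 0} 0 y} < ε) →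
    ∀ ε : ℝ, 0 < ε → ∃ᶠ n : ℕ in atTop,
      (bondPercolation (zdGraph 3) (criticalProbI 3)).real
          {ω | ∃ y : Site 3, y 0 = ((b * n : ℕ) : ℤ) ∧
            ω ∈ openConnIn {z : Site 3 | -((a * n : ℕ) : ℤ) < z 0} 0 y} < ε := by
  intro a b ha hab hhyp ε hε
  rcases eq_or_lt_of_le (measureReal_nonneg : 0 ≤ theta (zdGraph 3) 0 (criticalProbI 3)) with hθ | hθ
  · exact OffFloor.offFloor_of_theta_eq_zero hθ.symm a b (by omega) ε hε
  · obtain ⟨η, hη, N, hN⟩ :=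
      OffFloor.climb_eventually_ge_of_linearScaleLRO_of_theta_pos hX hθ ha (b + 1)
    obtain ⟨n, hlt, hn⟩ := ((hhyp η hη).and_eventually (eventually_ge_atTop N)).exists
    exact absurd (hN n hn) (not_le.2 hlt)

namespace OffFloor

/-- **Under `LinearScaleLROOfTheta` the unit-ratio stub already forces continuity**:
`UnitRatioBGN` (`∃ b₀, liminf_m P_{p_c}(E(m, b₀ m)) = 0`) implies `θ(p_c) = 0`. [folklore] -/
theorem theta_eq_zero_of_unitRatioBGN_of_linearScaleLROOfTheta
    (hX : Theses.PercFiniteBoxLRO.LinearScaleLROOfTheta)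
    (hU : ∃ b₀ : ℕ, ∀ ε : ℝ, 0 < ε → ∃ᶠ m : ℕ in atTop,
      (bondPercolation (zdGraph 3) (criticalProbI 3)).real
        {ω | ∃ y : Site 3, y 0 = ((b₀ * m : ℕ) : ℤ) ∧
          ω ∈ openConnIn {z : Site 3 | -((m : ℕ) : ℤ) < z 0} 0 y} < ε) :
    theta (zdGraph 3) 0 (criticalProbI 3) = 0 := by
  rcases eq_or_lt_of_le (measureReal_nonneg : 0 ≤ theta (zdGraph 3) 0 (criticalProbI 3)) with hθ | hθ
  · exact hθ.symm
  · exfalso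
    obtain ⟨b₀, hb₀⟩ := hU
    obtain ⟨η, hη, N, hN⟩ :=
      climb_eventually_ge_of_linearScaleLRO_of_theta_pos hX hθ (le_refl 1) b₀
    obtain ⟨n, hlt, hn⟩ := ((hb₀ η hη).and_eventually (eventually_ge_atTop N)).exists
    have := hN n hn
    simp only [one_mul] at this
    exact absurd this (not_le.2 hlt)

/-- **Under `LinearScaleLROOfTheta`, `BGNOffTheFloor ⟺ θ(p_c) = 0`** (`←` is θ-blind and
unconditional: `bgnOffTheFloor_of_theta_eq_zero`; `→` goes through the instance `(1, 2)`). [folklore] -/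
theorem bgnOffTheFloor_iff_continuity_of_linearScaleLROOfTheta
    (hX : Theses.PercFiniteBoxLRO.LinearScaleLROOfTheta) :
    Theses.PercGamblersRuin.BGNOffTheFloor ↔ _root_.PercolationContinuityZ3 := by
  change _ ↔ Literature.Probability.Percolation.PercolationContinuityZ3
  rw [percolationContinuityZ3_iff]
  refine ⟨fun h => ?_, bgnOffTheFloor_of_theta_eq_zero⟩
  refine theta_eq_zero_of_unitRatioBGN_of_linearScaleLROOfTheta hX ⟨2, fun ε hε => ?_⟩
  simpa only [one_mul] using h 1 2 (by omega) ε hε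

/-- **Under axial linear-scale LRO at `p_c` (in a jump world) the unit-ratio stub forces continuity**:
`UnitRatioBGN → θ(p_c) = 0`. [folklore] -/
theorem theta_eq_zero_of_unitRatioBGN_of_axialLRO
    (hAx : 0 < theta (zdGraph 3) 0 (criticalProbI 3) →
      ∃ ρ : ℝ, 0 < ρ ∧ ∃ K : ℕ, ∀ m : ℕ, 1 ≤ m →
        ρ ≤ (bondPercolation (zdGraph 3) (criticalProbI 3)).real
          (openConnIn (↑(box 3 (K * m)) : Set (Site 3)) (Pi.single 0 (-(m : ℤ))) (Pi.single 0 (m : ℤ))))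
    (hU : ∃ b₀ : ℕ, ∀ ε : ℝ, 0 < ε → ∃ᶠ m : ℕ in atTop,
      (bondPercolation (zdGraph 3) (criticalProbI 3)).real
        {ω | ∃ y : Site 3, y 0 = ((b₀ * m : ℕ) : ℤ) ∧
          ω ∈ openConnIn {z : Site 3 | -((m : ℕ) : ℤ) < z 0} 0 y} < ε) :
    theta (zdGraph 3) 0 (criticalProbI 3) = 0 := by
  rcases eq_or_lt_of_le (measureReal_nonneg : 0 ≤ theta (zdGraph 3) 0 (criticalProbI 3)) with hθ | hθ
  · exact hθ.symm
  · exfalso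
    obtain ⟨b₀, hb₀⟩ := hU
    obtain ⟨η, hη, N, hN⟩ := climb_eventually_ge_of_axialLRO_of_theta_pos hAx hθ (le_refl 1) b₀
    obtain ⟨n, hlt, hn⟩ := ((hb₀ η hη).and_eventually (eventually_ge_atTop N)).exists
    have := hN n hn
    simp only [one_mul] at this
    exact absurd this (not_le.2 hlt)

end OffFloor

/-- **Glue stub `stub_climbExtensionOfAxialLRO` of line `registered` (birth) of `BGNOffTheFloor`,
registered signature verbatim.** AXIAL linear-scale long-range order at `p_c` in a jump world
(`θ(p_c) > 0 → ∃ ρ > 0, K, ∀ m ≥ 1, P_{p_c}(-m e₀ ↔ m e₀ in Λ(K m)) ≥ ρ` — the axial instances at `p_c` of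
the crux `LinearScaleLROOfTheta` of route `PercFiniteBoxLRO`) implies the ladder step `ClimbExtension`
(`1 ≤ a < b`: `liminf_n e_n(a,b+1) = 0 → liminf_n e_n(a,b) = 0`), θ-blindly: `θ(p_c) = 0` gives the
conclusion outright (`OffFloor.offFloor_of_theta_eq_zero`), and `θ(p_c) > 0` refutes the hypothesis
(`OffFloor.climb_eventually_ge_of_axialLRO_of_theta_pos`). [folklore] -/
theorem stub_climbExtensionOfAxialLRO :
    (0 < theta (zdGraph 3) 0 (criticalProbI 3) →
      ∃ ρ : ℝ, 0 < ρ ∧ ∃ K : ℕ, ∀ m : ℕ, 1 ≤ m →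
        ρ ≤ (bondPercolation (zdGraph 3) (criticalProbI 3)).real
          (openConnIn (↑(box 3 (K * m)) : Set (Site 3)) (Pi.single 0 (-(m : ℤ))) (Pi.single 0 (m : ℤ)))) →
    ∀ a b : ℕ, 1 ≤ a → a < b →
      (∀ ε : ℝ, 0 < ε → ∃ᶠ n : ℕ in atTop,
        (bondPercolation (zdGraph 3) (criticalProbI 3)).real
            {ω | ∃ y : Site 3, y 0 = (((b + 1) * n : ℕ) : ℤ) ∧
              ω ∈ openConnIn {z : Site 3 | -((a * n : ℕ) : ℤ) < z 0} 0 y} < ε) →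
      ∀ ε : ℝ, 0 < ε → ∃ᶠ n : ℕ in atTop,
        (bondPercolation (zdGraph 3) (criticalProbI 3)).real
            {ω | ∃ y : Site 3, y 0 = ((b * n : ℕ) : ℤ) ∧
              ω ∈ openConnIn {z : Site 3 | -((a * n : ℕ) : ℤ) < z 0} 0 y} < ε := by
  intro hAx a b ha hab hhyp ε hε
  rcases eq_or_lt_of_le (measureReal_nonneg : 0 ≤ theta (zdGraph 3) 0 (criticalProbI 3)) with hθ | hθ
  · exact OffFloor.offFloor_of_theta_eq_zero hθ.symm a b (by omega) ε hε
  · obtain ⟨η, hη, N, hN⟩ := OffFloor.climb_eventually_ge_of_axialLRO_of_theta_pos hAx hθ ha (b + 1)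
    obtain ⟨n, hlt, hn⟩ := ((hhyp η hη).and_eventually (eventually_ge_atTop N)).exists
    exact absurd (hN n hn) (not_le.2 hlt)

end Summit.CriticalPhenomena.PercolationContinuityZ3.Theorems

end
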